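import Summits.HodgeConjecture.CorCM.AbelianTwoPowerCMTypes
import Literature.AlgebraicGeometry.Pohlmann1968.WeilTypeCMSubfieldExceptionalClasses
import HarnessLib

/-!
# Abelian CM fields of `2`-power degree: DEGENERATE = WEIL TYPE over a CM subfield — and then every realisation
# of a primitive type carries an exceptional Hodge class on the variety itself

COR-CM (cell `pub-hodgecm2`), binder seat b04 (gen 12), count-neutral, claim TWO-POWER-CRITERION part II; subfield
form of `CorCM/AbelianTwoPowerCMTypes`.  KERNEL ONLY: theorems; no definition, no named fact, no `sorry`.

Let `K` be a CM field, normal over `ℚ` with ABELIAN Galois group `G`.  For an odd character `χ` of `G` let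
`k = K^{ker χ}` (an intermediate field whose Galois group `G/ker χ` is cyclic; `k` has a complex place because
complex conjugation `ρ ∉ ker χ`).  Indexing the embeddings by `σ_g = φ₀ ∘ g⁻¹` (Shimura §8.1), two embeddings
`σ_g, σ_{g'}` restrict to the same embedding of `k` iff `χ(g) = χ(g')` (`comp_eq_comp_iff_of_ker`, Galois
correspondence `fixingSubgroup (fixedField H) = H`), so

* `fibres_balanced_of_equidistributed` — if `{g | σ_g ∈ Φ}` is EQUIDISTRIBUTED over `χ` (as many `g` with
  `χ(g) = v` as with `χ(g) = −v` for every value `v`) then `Φ` is BALANCED over `k`: every embedding `τ` of `k` has as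
  many extensions inside `Φ` as outside (Yanai's `a = b`; for `[k:ℚ] = 2` this is Weil type `(n/2, n/2)`);
* `exists_fibres_balanced_of_not_isNondegenerate` — hence, by the criterion of part I
  (`AbelianTwoPower.isNondegenerate_iff_forall_not_equidistributed`), **for `[K:ℚ] = 2^{n+1}` every DEGENERATE CM
  type of `K` is balanced over some intermediate field with a complex place**, and conversely
  (`not_isNondegenerate_iff_exists_fibres_balanced`, ⟸ being Yanai's theorem, tree
  `Pohlmann1968.not_isNondegenerate_of_fibres_balanced`, valid for every CM field): in `2`-power degree,
  DEGENERATE ⟺ GENERALISED WEIL TYPE over a subfield;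
* `exists_exceptional_of_isPrimitive_of_not_isNondegenerate` — consequently every realisation `(A, ι, θ)` of a
  PRIMITIVE degenerate CM type of such a `K` carries a rational `(m,m)`-class OUTSIDE `Dᵐ(A) ⊗ ℂ` on `A` ITSELF, in the
  degree `2m = [K : k]` (the Mumford–Pohlmann mechanism, tree `exists_exceptional_of_fibres_balanced'`) — sharper
  than Hazama's "on some power `Aⁿ`" (`exists_exceptional_pow_of_not_isNondegenerate`), which is all one gets for the
  degenerate types of `ℚ(ζ₁₃)` or `ℚ(ζ₁₉)` (not balanced over any subfield).

Instances: `ℚ(ζ₃₂)` (Lenstra's two types, Gordon 9.4.2: balanced `(4,4)` over `ℚ(i)`, resp. `(2,2)` over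
`ℚ(ζ₈)`), `ℚ(ζ₁₆)`, `ℚ(ζ₄₀)`, `ℚ(ζ₄₈)`, `ℚ(ζ₆₀)`, `ℚ(ζ_{2^k})`, the cyclic octic `ℚ(ζ₃₂ − ζ₃₂⁻¹)` …: for these
fields the `128`/`256` (resp. `8`/`16`) degenerate types of the offline census are exactly the generalised Weil
types.

## References

* [Gordon1999HodgeAVSurvey] B. B. Gordon, *A survey of the Hodge conjecture for abelian varieties*, 5.13 (ii), §9.2,
  §9.4.2, §9.4.3 (Theorem [B.140] = Yanai 1994).
* [Kubota1965] T. Kubota, *On the field extension by complex multiplication*, Trans. AMS 118 (1965), §4 Lemma 2.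
* [Shimura1998] G. Shimura, *Abelian Varieties with Complex Multiplication and Modular Functions*, §8.1, §8.2
  Prop. 26, §18.2 Lemma.
* [Pohlmann1968] H. Pohlmann, *Algebraic cycles on abelian varieties of complex multiplication type*, Ann. of Math.
  88 (1968), Thm. 1, §3.
-/

noncomputable section

open CategoryTheory NumberField

namespace Summit.HodgeConjecture.CorCM.AbelianTwoPower

open Literature.NumberTheory.ComplexMultiplication
open Literature.AlgebraicGeometry.Motives (AbelianVariety CMType)
open Literature.AlgebraicGeometry.HodgeTheory
open Literature.AlgebraicGeometry.ComplexMultiplication (IsCMTypeRealisation)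
open Literature.AlgebraicGeometry.Pohlmann1968
open Literature.Barriers.HodgeConjecture (divisorClassesSpan)
open Summit.HodgeConjecture.CorCM.CyclicTwoPower (exists_conj_gal)

open scoped Classical

variable {K : Type} [Field K] [NumberField K] [IsCMField K] [Normal ℚ K]

/-! ### §1 Restriction of `σ_g = φ₀ ∘ g⁻¹` to a fixed field -/

omit [IsCMField K] [Normal ℚ K] in
/-- **Two embeddings `σ_g`, `σ_{g'}` agree on the fixed field `K^H` iff `g' g⁻¹ ∈ H`** (Artin:
`Aut(K/K^H) = H` for a finite extension, Mathlib `IntermediateField.fixingSubgroup_fixedField`). [cite: Shimura1998, §8.1] -/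
theorem embOf_comp_eq_iff (φ₀ : K →+* ℂ) (H : Subgroup (K ≃ₐ[ℚ] K)) (g g' : K ≃ₐ[ℚ] K) :
    (embOf φ₀ g).comp (algebraMap (IntermediateField.fixedField H) K) =
        (embOf φ₀ g').comp (algebraMap (IntermediateField.fixedField H) K) ↔ g' * g⁻¹ ∈ H := by
  -- `σ_g|_k = σ_{g'}|_k ↔ g'g⁻¹` fixes `k` pointwise
  have key : (embOf φ₀ g).comp (algebraMap (IntermediateField.fixedField H) K) =
      (embOf φ₀ g').comp (algebraMap (IntermediateField.fixedField H) K) ↔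
      ∀ x ∈ IntermediateField.fixedField H, (g' * g⁻¹) x = x := by
    constructor
    · intro h x hx
      have hx' := DFunLike.congr_fun h ⟨x, hx⟩
      simp only [RingHom.coe_comp, Function.comp_apply, embOf_apply] at hx'
      have h1 : g.symm x = g'.symm x := φ₀.injective hx'
      change g' (g⁻¹ x) = x
      rw [show g⁻¹ x = g.symm x from rfl, h1]
      exact g'.apply_symm_apply x
    · intro h
      refine RingHom.ext fun x => ?_
      simp only [RingHom.coe_comp, Function.comp_apply, embOf_apply]
      congr 1
      have hx := h x.1 x.2
      change g' (g⁻¹ (x : K)) = x at hx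
      have : g'.symm (g' (g⁻¹ (x : K))) = g'.symm x := by rw [hx]
      rw [g'.symm_apply_apply] at this
      exact this
  rw [key, ← IntermediateField.mem_fixingSubgroup_iff, IntermediateField.fixingSubgroup_fixedField]

omit [IsCMField K] [Normal ℚ K] in
/-- The kernel of a character of `Gal(K/ℚ)`, as a subgroup. [folklore] -/
private theorem exists_ker (χ : AddChar (Additive (K ≃ₐ[ℚ] K)) ℂ) :
    ∃ H : Subgroup (K ≃ₐ[ℚ] K), ∀ g, g ∈ H ↔ χ (Additive.ofMul g) = 1 :=
  ⟨{ carrier := {g | χ (Additive.ofMul g) = 1}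
     mul_mem' := fun {a b} ha hb => by
       simp only [Set.mem_setOf_eq] at ha hb ⊢
       rw [ofMul_mul, AddChar.map_add_eq_mul, ha, hb, one_mul]
     one_mem' := by simp only [Set.mem_setOf_eq, ofMul_one, AddChar.map_zero_eq_one]
     inv_mem' := fun {a} ha => by
       simp only [Set.mem_setOf_eq] at ha ⊢
       rw [ofMul_inv, AddChar.map_neg_eq_inv, ha, inv_one] }, fun _ => Iff.rfl⟩

omit [IsCMField K] [Normal ℚ K] in
/-- For the kernel `H = ker χ`: `σ_g|_{K^H} = σ_{g'}|_{K^H} ↔ χ(g) = χ(g')`. [cite: Shimura1998, §8.1] -/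
theorem embOf_comp_eq_iff_of_ker (φ₀ : K →+* ℂ) (χ : AddChar (Additive (K ≃ₐ[ℚ] K)) ℂ) (H : Subgroup (K ≃ₐ[ℚ] K))
    (hH : ∀ g, g ∈ H ↔ χ (Additive.ofMul g) = 1) (g g' : K ≃ₐ[ℚ] K) :
    (embOf φ₀ g).comp (algebraMap (IntermediateField.fixedField H) K) =
        (embOf φ₀ g').comp (algebraMap (IntermediateField.fixedField H) K) ↔
      χ (Additive.ofMul g) = χ (Additive.ofMul g') := by
  have hne : χ (Additive.ofMul g) ≠ 0 := fun h0 => by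
    have h := addChar_pow_card_eq_one χ g
    rw [h0, zero_pow Fintype.card_ne_zero] at h
    exact zero_ne_one h
  rw [embOf_comp_eq_iff φ₀ H g g', hH, ofMul_mul, ofMul_inv, AddChar.map_add_eq_mul, AddChar.map_neg_eq_inv,
    mul_inv_eq_one₀ hne, eq_comm]

/-! ### §2 Equidistributed over `χ` ⟹ balanced over `K^{ker χ}` -/

omit [IsCMField K] in
/-- **Equidistribution over an odd character is Yanai's balance condition over the fixed field of its kernel.**
For `K/ℚ` normal with abelian Galois group, `ρ` the complex conjugation (`φ₀ ∘ ρ = conj ∘ φ₀`), `χ` a character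
with `χ(ρ) = −1` over which `{g | σ_g ∈ Φ}` is equidistributed, and `k = K^{ker χ}`: every embedding `τ` of `k` has
as many extensions in `Φ` as outside `Φ`. [cite: Gordon1999HodgeAVSurvey, §9.4.3 (Theorem [B.140])]
[cite: Shimura1998, §8.1, §18.2 Lemma (i)] -/
theorem fibres_balanced_of_equidistributed (hcomm : ∀ g h : K ≃ₐ[ℚ] K, g * h = h * g) (Φ : CMType K)
    (φ₀ : K →+* ℂ) (ρ : K ≃ₐ[ℚ] K) (hρ : ∀ x, φ₀ (ρ x) = starRingEnd ℂ (φ₀ x))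
    (χ : AddChar (Additive (K ≃ₐ[ℚ] K)) ℂ) (hχ : χ (Additive.ofMul ρ) = -1)
    (hE : ∀ g : K ≃ₐ[ℚ] K,
      ((Finset.univ.filter fun g' : K ≃ₐ[ℚ] K => embOf φ₀ g' ∈ Φ.1).filter
          fun g' => χ (Additive.ofMul g') = χ (Additive.ofMul g)).card =
        ((Finset.univ.filter fun g' : K ≃ₐ[ℚ] K => embOf φ₀ g' ∈ Φ.1).filter
          fun g' => χ (Additive.ofMul g') = -χ (Additive.ofMul g)).card)
    (H : Subgroup (K ≃ₐ[ℚ] K)) (hH : ∀ g, g ∈ H ↔ χ (Additive.ofMul g) = 1)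
    (τ : IntermediateField.fixedField H →+* ℂ) :
    {φ : K →+* ℂ | φ.comp (algebraMap (IntermediateField.fixedField H) K) = τ ∧ φ ∈ Φ.1}.ncard =
      {φ : K →+* ℂ | φ.comp (algebraMap (IntermediateField.fixedField H) K) = τ ∧ φ ∉ Φ.1}.ncard := by
  set j : IntermediateField.fixedField H →+* K := algebraMap (IntermediateField.fixedField H) K with hj
  have hcm := isCMTypeWith_gal hcomm Φ φ₀ ρ hρ
  -- every `φ` is `σ_g`; transport both sets to `Gal(K/ℚ)`
  have htrans : ∀ P : (K →+* ℂ) → Prop, {φ : K →+* ℂ | φ.comp j = τ ∧ P φ}.ncard =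
      (Finset.univ.filter fun g : K ≃ₐ[ℚ] K => (embOf φ₀ g).comp j = τ ∧ P (embOf φ₀ g)).card := by
    intro P
    have himage : {φ : K →+* ℂ | φ.comp j = τ ∧ P φ} =
        embOf φ₀ '' (↑(Finset.univ.filter fun g : K ≃ₐ[ℚ] K => (embOf φ₀ g).comp j = τ ∧ P (embOf φ₀ g))) := by
      ext φ
      simp only [Set.mem_setOf_eq, Set.mem_image, Finset.coe_filter, Finset.mem_univ, true_and]
      constructor
      · intro h
        obtain ⟨g, rfl⟩ := (embOf_bijective φ₀).2 φ
        exact ⟨g, h, rfl⟩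
      · rintro ⟨g, h, rfl⟩
        exact h
    rw [himage, Set.ncard_image_of_injective _ (embOf_bijective φ₀).1, Set.ncard_coe_finset]
  rw [htrans (fun φ => φ ∈ Φ.1), htrans (fun φ => φ ∉ Φ.1)]
  -- is `τ` a restriction of some `σ_{g₀}`?
  by_cases hτ : ∃ g₀ : K ≃ₐ[ℚ] K, (embOf φ₀ g₀).comp j = τ
  · obtain ⟨g₀, hg₀⟩ := hτ
    have hfib : ∀ g, (embOf φ₀ g).comp j = τ ↔ χ (Additive.ofMul g) = χ (Additive.ofMul g₀) := fun g => by
      rw [← hg₀]; exact embOf_comp_eq_iff_of_ker φ₀ χ H hH g g₀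
    simp_rw [hfib]
    -- inside `Φ`: the equidistribution count at `g₀`
    have h1 : (Finset.univ.filter fun g : K ≃ₐ[ℚ] K =>
        χ (Additive.ofMul g) = χ (Additive.ofMul g₀) ∧ embOf φ₀ g ∈ Φ.1).card =
        ((Finset.univ.filter fun g' : K ≃ₐ[ℚ] K => embOf φ₀ g' ∈ Φ.1).filter
          fun g' => χ (Additive.ofMul g') = χ (Additive.ofMul g₀)).card := by
      rw [Finset.filter_filter]
      congr 1
      exact Finset.filter_congr fun g _ => and_comm
    -- outside `Φ`: `g ↦ ρg` carries it onto the count at `−χ(g₀)` inside `Φ`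
    have hρχ : ∀ g, χ (Additive.ofMul (ρ * g)) = -χ (Additive.ofMul g) := fun g => by
      rw [ofMul_mul, AddChar.map_add_eq_mul, hχ, neg_one_mul]
    have hρρ : ∀ g : K ≃ₐ[ℚ] K, ρ * (ρ * g) = g := fun g => by
      have := hcm.invol g; simpa [smul_eq_mul] using this
    have h2 : (Finset.univ.filter fun g : K ≃ₐ[ℚ] K =>
        χ (Additive.ofMul g) = χ (Additive.ofMul g₀) ∧ embOf φ₀ g ∉ Φ.1).card =
        ((Finset.univ.filter fun g' : K ≃ₐ[ℚ] K => embOf φ₀ g' ∈ Φ.1).filter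
          fun g' => χ (Additive.ofMul g') = -χ (Additive.ofMul g₀)).card := by
      rw [Finset.filter_filter]
      refine Finset.card_bij (fun g _ => ρ * g) (fun g hg => ?_) (fun a _ b _ h => ?_) (fun g hg => ?_)
      · simp only [Finset.mem_filter, Finset.mem_univ, true_and] at hg ⊢
        refine ⟨?_, by rw [hρχ, hg.1]⟩
        have := (hcm.rho_smul_mem_iff g).2 hg.2
        simpa [smul_eq_mul] using this
      · simpa [hρρ] using congrArg (fun x => ρ * x) h
      · simp only [Finset.mem_filter, Finset.mem_univ, true_and] at hg
        refine ⟨ρ * g, ?_, hρρ g⟩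
        simp only [Finset.mem_filter, Finset.mem_univ, true_and]
        refine ⟨by rw [hρχ, hg.2, neg_neg], ?_⟩
        have := (hcm.mem_iff g).1 hg.1
        simpa [smul_eq_mul] using this
    rw [h1, h2]
    exact hE g₀
  · -- no `σ_g` restricts to `τ`: both counts vanish
    push Not at hτ
    have h0 : ∀ P : (K →+* ℂ) → Prop,
        (Finset.univ.filter fun g : K ≃ₐ[ℚ] K => (embOf φ₀ g).comp j = τ ∧ P (embOf φ₀ g)).card = 0 := by
      intro P
      rw [Finset.card_eq_zero, Finset.eq_empty_iff_forall_notMem]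
      exact fun g hg => hτ g (Finset.mem_filter.1 hg).2.1
    rw [h0 (fun φ => φ ∈ Φ.1), h0 (fun φ => φ ∉ Φ.1)]

omit [IsCMField K] [Normal ℚ K] in
/-- The fixed field of `ker χ` for an ODD character has a complex place: `φ₀|_k` is not real, since `ρ ∉ ker χ` does
not fix `k = K^{ker χ}` pointwise (Galois correspondence). [cite: Shimura1998, §18.2 Lemma (i)] -/
theorem conjugate_restrict_ne (φ₀ : K →+* ℂ) (ρ : K ≃ₐ[ℚ] K)
    (hρ : ∀ x, φ₀ (ρ x) = starRingEnd ℂ (φ₀ x)) (χ : AddChar (Additive (K ≃ₐ[ℚ] K)) ℂ)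
    (hχ : χ (Additive.ofMul ρ) = -1) (H : Subgroup (K ≃ₐ[ℚ] K)) (hH : ∀ g, g ∈ H ↔ χ (Additive.ofMul g) = 1) :
    ComplexEmbedding.conjugate (φ₀.comp (algebraMap (IntermediateField.fixedField H) K)) ≠
      φ₀.comp (algebraMap (IntermediateField.fixedField H) K) := by
  intro h
  -- `conj ∘ φ₀ = σ_{ρ⁻¹}` restricted to `k` equals `σ_1|_k`, so `χ(ρ⁻¹) = χ(1) = 1`
  have hρinv : ∀ x, φ₀ (ρ⁻¹ x) = starRingEnd ℂ (φ₀ x) := fun x => by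
    have hρρ : ρ * ρ = 1 := by
      apply AlgEquiv.ext; intro y; apply φ₀.injective
      rw [AlgEquiv.mul_apply, hρ, hρ, starRingEnd_self_apply, AlgEquiv.one_apply]
    rw [show ρ⁻¹ = ρ by rw [inv_eq_iff_mul_eq_one, hρρ], hρ]
  have h1 : (embOf φ₀ ρ).comp (algebraMap (IntermediateField.fixedField H) K) =
      (embOf φ₀ 1).comp (algebraMap (IntermediateField.fixedField H) K) := by
    refine RingHom.ext fun x => ?_
    have hx := DFunLike.congr_fun h x
    rw [ComplexEmbedding.conjugate_coe_eq, RingHom.comp_apply] at hx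
    rw [RingHom.comp_apply, RingHom.comp_apply, embOf_apply, embOf_apply,
      show ρ.symm (algebraMap _ K x) = ρ⁻¹ (algebraMap _ K x) from rfl, hρinv, hx]
    rfl
  have h2 := (embOf_comp_eq_iff_of_ker φ₀ χ H hH ρ 1).1 h1
  rw [hχ, ofMul_one, AddChar.map_zero_eq_one] at h2
  norm_num at h2

/-! ### §3 Degenerate ⟺ balanced over a subfield, in `2`-power degree -/

/-- **In `2`-power degree, every DEGENERATE CM type is of generalised Weil type**: for `K` CM, normal over `ℚ`,
with abelian Galois group of order `[K:ℚ] = 2^{n+1}`, and `Φ` degenerate, there is an intermediate field `k` with a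
complex place over which `Φ` is balanced (every embedding of `k` has as many extensions in `Φ` as outside).
[cite: Kubota1965, §4 Lemma 2] [cite: Gordon1999HodgeAVSurvey, §9.4.2, §9.4.3] -/
theorem exists_fibres_balanced_of_not_isNondegenerate (hcomm : ∀ g h : K ≃ₐ[ℚ] K, g * h = h * g) {n : ℕ}
    (hK : Module.finrank ℚ K = 2 ^ (n + 1)) (Φ : CMType K) (hΦ : ¬IsNondegenerate Φ) :
    ∃ k : IntermediateField ℚ K,
      (∃ τ₀ : k →+* ℂ, ComplexEmbedding.conjugate τ₀ ≠ τ₀) ∧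
      ∀ τ : k →+* ℂ, {φ : K →+* ℂ | φ.comp (algebraMap k K) = τ ∧ φ ∈ Φ.1}.ncard =
        {φ : K →+* ℂ | φ.comp (algebraMap k K) = τ ∧ φ ∉ Φ.1}.ncard := by
  obtain ⟨φ₀⟩ := (inferInstance : Nonempty (K →+* ℂ))
  obtain ⟨ρ, hρ⟩ := exists_conj_gal (K := K)
  have h := (isNondegenerate_iff_forall_not_equidistributed hcomm hK Φ φ₀ ρ (hρ φ₀)).not.1 hΦ
  push Not at h
  obtain ⟨χ, hχ, hE⟩ := h
  obtain ⟨H, hH⟩ := exists_ker χ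
  exact ⟨IntermediateField.fixedField H, ⟨_, conjugate_restrict_ne φ₀ ρ (hρ φ₀) χ hχ H hH⟩,
    fibres_balanced_of_equidistributed hcomm Φ φ₀ ρ (hρ φ₀) χ hχ hE H hH⟩

/-- **DEGENERATE ⟺ GENERALISED WEIL TYPE, for abelian CM fields of `2`-power degree.**  (⟸ is Yanai's theorem,
`a = b`, valid for every CM field: tree `Pohlmann1968.not_isNondegenerate_of_fibres_balanced`.)
[cite: Gordon1999HodgeAVSurvey, §9.4.3 (Theorem [B.140])] [cite: Kubota1965, §4 Lemma 2] -/
theorem not_isNondegenerate_iff_exists_fibres_balanced (hcomm : ∀ g h : K ≃ₐ[ℚ] K, g * h = h * g) {n : ℕ}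
    (hK : Module.finrank ℚ K = 2 ^ (n + 1)) (Φ : CMType K) :
    ¬IsNondegenerate Φ ↔ ∃ k : IntermediateField ℚ K,
      (∃ τ₀ : k →+* ℂ, ComplexEmbedding.conjugate τ₀ ≠ τ₀) ∧
      ∀ τ : k →+* ℂ, {φ : K →+* ℂ | φ.comp (algebraMap k K) = τ ∧ φ ∈ Φ.1}.ncard =
        {φ : K →+* ℂ | φ.comp (algebraMap k K) = τ ∧ φ ∉ Φ.1}.ncard :=
  ⟨exists_fibres_balanced_of_not_isNondegenerate hcomm hK Φ, fun ⟨k, ⟨_, hτ₀⟩, hW⟩ =>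
    not_isNondegenerate_of_fibres_balanced (algebraMap k K) hW hτ₀⟩

/-! ### §4 Exceptional Hodge classes on the variety itself -/

variable {Φ : CMType K} {A : AbelianVariety ℂ} {ι : 𝓞 K →+* End A} {θ : K →+* Module.End ℂ (complexBetti A.X 1)}

/-- **A realisation of a PRIMITIVE DEGENERATE CM type of an abelian CM field of `2`-power degree carries an
exceptional Hodge class on the variety ITSELF**: there are `m` and a rational `(m,m)`-class on `A` outside
`Dᵐ(A) ⊗ ℂ`, `2m = [K : k]` for the subfield `k` of `exists_fibres_balanced_of_not_isNondegenerate` — the Weil class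
of `(A, k)` (Mumford–Pohlmann mechanism, tree `exists_exceptional_of_fibres_balanced'`).  Compare Hazama's converse,
which only yields a class on SOME POWER `Aⁿ`. [cite: Gordon1999HodgeAVSurvey, 5.13 (ii), 9.2.2, §9.4.3]
[cite: Pohlmann1968, Thm. 1 and §3] -/
theorem exists_exceptional_of_isPrimitive_of_not_isNondegenerate (hcomm : ∀ g h : K ≃ₐ[ℚ] K, g * h = h * g)
    {n : ℕ} (hK : Module.finrank ℚ K = 2 ^ (n + 1)) (φ₀ : K →+* ℂ) (hprim : IsPrimitive (ℂ ≃+* ℂ) Φ.1 φ₀)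
    (hdeg : ¬IsNondegenerate Φ) (hA : IsCMTypeRealisation Φ A ι θ) :
    ∃ m : ℕ, ∃ c : complexBetti A.X (2 * m), IsRationalClass c ∧
      IsOfHodgeType (Module.finrank ℚ K / 2) A.X (2 * m) m m c ∧
      c ∉ divisorClassesSpan A.X (Module.finrank ℚ K / 2) m := by
  obtain ⟨k, ⟨τ₀, hτ₀⟩, hW⟩ := exists_fibres_balanced_of_not_isNondegenerate hcomm hK Φ hdeg
  obtain ⟨m, -, hc⟩ := exists_exceptional_of_fibres_balanced' (algebraMap k K) φ₀ hprim hW hτ₀ hA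
  exact ⟨m, hc⟩

end Summit.HodgeConjecture.CorCM.AbelianTwoPower

end
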